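import Literature.MathematicalPhysics.QuantumLattice.HubbardHubbardModelPairDecayProofs
import Literature.MathematicalPhysics.QuantumLattice.HubbardGaugeBoundSharp
import Literature.MathematicalPhysics.QuantumLattice.TorusLogDipole
import HarnessLib
import HarnessLib.Audit

/-!
# Hubbard ladder — Bounds: the logarithmic dipole and the machine-checked `η`-lines
# `T ≥ 2.03|t|` (tree hopping norm) and `T ≥ 1.02|t|` (Koma–Tasaki's printed norm)
# (bounds.tex Thm 10 / Cor 10.1 / Remark 10′; sequel to `PairCorrelationEtaLine.lean`)

HONEST FRAMING (cell pub-hubbard): ladder R1–R4 with certified numbers; no claim on H/H₀. These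
are bounds for a MODEL CLASS — the grand-canonical Hubbard model `hubbardTorusWith 2 L t U μ` on
the square torus `(ℤ/Lℤ)²` (every `L ≥ 1`, all real `t, U, μ`, every `β > 0`); no materials
claim. Companion text: `pub-hubbard/paper/bounds.tex` §Theorem 10 and Remark 10′; tables
`pub-hubbard/pub-hubbard-bounds/BOUNDS.md` (rows T8, T8′, T8″) and `EXTREMISERS.md` §5c.

## Content

`PairCorrelationEtaLine.lean` machine-checks the Koma–Tasaki `η = 1/4` line only for
`T > 32|t|` (tree constants: energy `128 q² H` of the radial test potential, hopping norm `2`).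
Two inputs, both now in the Literature tree, close most of the gap to the paper's sharp
`T_{1/4} = (π/4)|t| ≈ 0.785|t|` (bounds.tex Thm 10, Euclidean dipole — NOT machine-checked):

1. the `ℓ^∞` McBryan–Spencer DIPOLE `TorusLogDipole.exists_logDipole` (gain `2qH(ρ)`, energy
   `≤ 16 q² e^{q²/2} H(ρ)`, `ρ = ⌊(dist-1)/2⌋`; sharp shell count `8s+4`), and
2. Koma–Tasaki's eq. (11) AS PRINTED, `‖c†_u c_v + c†_v c_u‖ ≤ 1`
   (`HubbardGaugeBoundSharp.norm_thermalCorr_pair_le_exp_sharp`: hopping-norm constant `a = 1`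
   instead of the tree's `a = 2`).

* `norm_pairCorr_le_rpow_dipole_of_apriori` — for ANY a priori gauge bound with hopping-norm
  constant `a ≥ 0` and every `q` with `f = 4q - 16 a β|t| q² e^{q²/2} ≥ 0`:
  `|G_{β,L}(x,y)| ≤ 4^f (dist(x,y)+1)^{-f}`, uniformly in `L`;
* `apriori_two` / `apriori_one` — the tree's (`a = 2`) and the printed (`a = 1`) a priori bounds,
  pulled back from the fermionic torus to `(ℤ/Lℤ)²`;
* `norm_pairCorr_le_rpow_dipole` (`a = 2`) and `norm_pairCorr_le_rpow_dipole_sharp` (`a = 1`) —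
  **machine-checked, explicit**: `|G_{β,L}(x,y)| ≤ 4^{f} (dist+1)^{-f}` with
  `f = 4q - 32 β|t| q² e^{q²/2}`, resp. `f = 4q - 16 β|t| q² e^{q²/2}`, every `q`;
* `PairEtaLineDipole` / `pairEtaLineDipole_holds` — **PROVED**: `β|t| ≤ 99/200` (`T ≥ 2.03|t|`)
  ⟹ `∃ f > 1/4, C`: `|G_{β,L}(x,y)| ≤ C (dist+1)^{-f}` for all `L, x, y` (and all `U, μ`);
* `PairEtaLineDipoleSharp` / `pairEtaLineDipoleSharp_holds` — **PROVED**: the same for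
  `β|t| ≤ 99/100` (`T ≥ 1.02|t|`). The `ℓ^∞`-method optimum is `β|t| < 0.992` (`T > 1.008|t|`);
  the remaining factor `4/π` to the paper's `(π/4)|t|` is `ℓ^∞` versus Euclidean shells
  (`8` bonds per unit of `log` versus `2π`), i.e. lattice potential theory not in Mathlib.

Reading (Cor 10.1): wherever `f > 1/4` is certified, algebraic pair order of Kosterlitz–Thouless
type with the Nelson–Kosterlitz exponent `η ≤ 1/4` is excluded, for every `U` and every filling;
in particular a KT superconducting phase of the 2D Hubbard model (any `U`, `μ`) can only occur at
`T < 1.02|t|` — unconditionally and machine-checked (the conditional stiffness route of Thms 1–9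
gives `T_c ≤ |t|/4` under NK_q).

References (keys of `lean/references.bib`): KomaTasakiPRL1992 (Theorem, eqs. (5)–(13), note 9);
McBryanSpencer1977; NelsonKosterlitz1977; FriedliVelenikSMLS2017 §3.1.
-/

noncomputable section

namespace Summit.HubbardSuperconductivity.HubbardLadder.Bounds

open Matrix Finset NormedSpace
open Literature.MathematicalPhysics.QuantumLattice Literature.Probability.LatticeModels
open scoped Matrix.Norms.L2Operator ComplexOrder

/-! ### From an a priori gauge bound to the power law -/

/-- **Dipole form of the Koma–Tasaki bound, parametric in the hopping-norm constant `a`.**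
Suppose the thermal pair correlation of `hubbardTorusWith 2 L t U μ` obeys, for every real site
function `φ`, the a priori gauge bound
`|G_{β,L}(x,y)| ≤ e^{-2(φ_x - φ_y)} exp[β |t| a Σ_u Σ_v [u∼v] (cosh(φ_u - φ_v) - 1)]`
(`a = 2`: tree `norm_thermalCorr_pair_le_exp`; `a = 1`: Koma–Tasaki eq. (11) as printed). Then
for every `q ≥ 0` with `f := 4q - 16 a β|t| q² e^{q²/2} ≥ 0`:
`|G_{β,L}(x,y)| ≤ 4^f (dist(x,y) + 1)^{-f}`, uniformly in `L` (dipole of radius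
`ρ = ⌊(dist - 1)/2⌋`, `H(ρ) ≥ log(ρ+1) ≥ log((dist+1)/4)`). -/
theorem norm_pairCorr_le_rpow_dipole_of_apriori (L : ℕ) [NeZero L] (t U μ β a q : ℝ)
    (hβ : 0 ≤ β) (ha : 0 ≤ a) (x y : TorusSite 2 L)
    (hAP : ∀ φ : TorusSite 2 L → ℝ,
      ‖(hubbardTorusWith 2 L t U μ).thermalCorr β (onSitePair x)ᴴ (onSitePair y)‖ ≤
        Real.exp (-2 * (φ x - φ y)) * Real.exp (β * (|t| * (a *
          ∑ u : TorusSite 2 L, ∑ v : TorusSite 2 L,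
            (if (torusGraph 2 L).Adj u v then (Real.cosh (φ u - φ v) - 1) else 0)))))
    (hf : 0 ≤ 4 * q - 16 * a * (β * |t|) * (q ^ 2 * Real.exp (q ^ 2 / 2))) :
    ‖(hubbardTorusWith 2 L t U μ).thermalCorr β (onSitePair x)ᴴ (onSitePair y)‖ ≤
      (4 : ℝ) ^ (4 * q - 16 * a * (β * |t|) * (q ^ 2 * Real.exp (q ^ 2 / 2))) *
        ((torusDist x y : ℝ) + 1) ^ (-(4 * q - 16 * a * (β * |t|) * (q ^ 2 * Real.exp (q ^ 2 / 2)))) := by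
  set c : ℝ := q ^ 2 * Real.exp (q ^ 2 / 2) with hc
  set f : ℝ := 4 * q - 16 * a * (β * |t|) * c with hfdef
  have hf0 : 0 ≤ f := hf
  set R : ℕ := torusDist x y with hR
  have hR1 : (0 : ℝ) < (R : ℝ) + 1 := by positivity
  have h4f : (1 : ℝ) ≤ (4 : ℝ) ^ f := Real.one_le_rpow (by norm_num) hf0
  rcases Nat.eq_zero_or_pos R with hR0 | hRpos
  · -- coincident sites: the bound with `φ = 0` is `1 ≤ 4^f`
    have h0 := hAP (fun _ => 0)
    simp only [sub_self, mul_zero, Real.cosh_zero, ite_self, sum_const_zero, Real.exp_zero,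
      mul_one] at h0
    rw [hR0, Nat.cast_zero, zero_add, Real.one_rpow, mul_one]
    exact h0.trans h4f
  · -- the dipole of radius `ρ = ⌊(R-1)/2⌋`
    set ρ : ℕ := (R - 1) / 2 with hρdef
    have hρR : 2 * ρ + 1 ≤ torusDist x y := by rw [← hR]; omega
    obtain ⟨φ, hgain, hE⟩ := exists_logDipole L x y q ρ hρR
    have key := hAP φ
    rw [hgain] at key
    have hβt : 0 ≤ β * |t| := by positivity
    have hHρ : Real.log ((ρ : ℝ) + 1) ≤ (harmonic ρ : ℝ) := by
      have := log_add_one_le_harmonic ρ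
      push_cast at this
      exact this
    have hρ1 : (0 : ℝ) < (ρ : ℝ) + 1 := by positivity
    have hquarter : ((R : ℝ) + 1) / 4 ≤ (ρ : ℝ) + 1 := by
      have h : R + 1 ≤ 4 * (ρ + 1) := by omega
      have h' : ((R : ℝ) + 1) ≤ 4 * ((ρ : ℝ) + 1) := by exact_mod_cast h
      linarith
    have hquarter0 : (0 : ℝ) < ((R : ℝ) + 1) / 4 := by positivity
    calc ‖(hubbardTorusWith 2 L t U μ).thermalCorr β (onSitePair x)ᴴ (onSitePair y)‖
        ≤ Real.exp (-2 * (2 * q * (harmonic ρ : ℝ))) * Real.exp (β * (|t| * (a *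
            ∑ u : TorusSite 2 L, ∑ v : TorusSite 2 L,
              (if (torusGraph 2 L).Adj u v then (Real.cosh (φ u - φ v) - 1) else 0)))) := key
      _ ≤ Real.exp (-2 * (2 * q * (harmonic ρ : ℝ))) *
            Real.exp (β * (|t| * (a * (16 * c * (harmonic ρ : ℝ))))) := by
          gcongr
      _ = Real.exp (-(f * (harmonic ρ : ℝ))) := by
          rw [← Real.exp_add, hfdef]
          congr 1
          ring
      _ ≤ Real.exp (-(f * Real.log ((ρ : ℝ) + 1))) := by
          gcongr
      _ = ((ρ : ℝ) + 1) ^ (-f) := by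
          rw [Real.rpow_def_of_pos hρ1]
          congr 1
          ring
      _ ≤ (((R : ℝ) + 1) / 4) ^ (-f) :=
          Real.rpow_le_rpow_of_nonpos hquarter0 hquarter (by linarith)
      _ = (4 : ℝ) ^ f * ((R : ℝ) + 1) ^ (-f) := by
          rw [Real.div_rpow hR1.le (by norm_num), Real.rpow_neg (by norm_num : (0:ℝ) ≤ 4),
            div_inv_eq_mul, mul_comm]

/-! ### The two a priori bounds, pulled back to `(ℤ/Lℤ)²` -/

/-- The pair correlation of `hubbardTorusWith` is the `hamiltonianWith` correlation of the
creation/annihilation monomials on the fermionic torus (definitional bookkeeping). -/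
theorem thermalCorr_onSitePair_eq (L : ℕ) [NeZero L] (t U μ β : ℝ) (x y : TorusSite 2 L) :
    (hubbardTorusWith 2 L t U μ).thermalCorr β (onSitePair x)ᴴ (onSitePair y) =
      (hamiltonianWith (fermionTorusGraph 2 L) t U μ).thermalCorr β
        (creation (orb (FermionTorus.ofTorusSite x) 0) *
          creation (orb (FermionTorus.ofTorusSite x) 1))
        (annihilation (orb (FermionTorus.ofTorusSite y) 1) *
          annihilation (orb (FermionTorus.ofTorusSite y) 0)) := by
  rw [onSitePair_conjTranspose]
  rfl

/-- **The tree's a priori bound on the torus (`a = 2`).** Pull-back of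
`norm_thermalCorr_pair_le_exp` (hopping norm counted as `2`), for every real site function `φ`
and `β ≥ 0`. -/
theorem apriori_two (L : ℕ) [NeZero L] (t U μ β : ℝ) (hβ : 0 ≤ β) (x y : TorusSite 2 L)
    (φ : TorusSite 2 L → ℝ) :
    ‖(hubbardTorusWith 2 L t U μ).thermalCorr β (onSitePair x)ᴴ (onSitePair y)‖ ≤
      Real.exp (-2 * (φ x - φ y)) * Real.exp (β * (|t| * (2 *
        ∑ u : TorusSite 2 L, ∑ v : TorusSite 2 L,
          (if (torusGraph 2 L).Adj u v then (Real.cosh (φ u - φ v) - 1) else 0)))) := by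
  have key := norm_thermalCorr_pair_le_exp (fermionTorusGraph 2 L) t U μ hβ
    (fun u => φ (FermionTorus.toTorusSite u)) (FermionTorus.ofTorusSite x)
    (FermionTorus.ofTorusSite y)
  have hsumeq : (∑ u : FermionTorus 2 L, ∑ v : FermionTorus 2 L,
      if (fermionTorusGraph 2 L).Adj u v then
        2 * (Real.cosh (φ (FermionTorus.toTorusSite u) - φ (FermionTorus.toTorusSite v)) - 1)
      else 0) =
      ∑ a : TorusSite 2 L, ∑ b : TorusSite 2 L,
        if (torusGraph 2 L).Adj a b then 2 * (Real.cosh (φ a - φ b) - 1) else 0 := by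
    refine Fintype.sum_equiv FermionTorus.equivTorusSite _ _ fun u => ?_
    refine Fintype.sum_equiv FermionTorus.equivTorusSite _ _ fun v => ?_
    simp [FermionTorus.equivTorusSite]
  have h2 : (∑ a : TorusSite 2 L, ∑ b : TorusSite 2 L,
      if (torusGraph 2 L).Adj a b then 2 * (Real.cosh (φ a - φ b) - 1) else 0) =
      2 * ∑ u : TorusSite 2 L, ∑ v : TorusSite 2 L,
        (if (torusGraph 2 L).Adj u v then (Real.cosh (φ u - φ v) - 1) else 0) := by
    rw [mul_sum]
    refine sum_congr rfl fun u _ => ?_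
    rw [mul_sum]
    refine sum_congr rfl fun v _ => ?_
    split_ifs
    · rfl
    · rw [mul_zero]
  simp only [FermionTorus.toTorusSite_ofTorusSite] at key
  rw [hsumeq, h2] at key
  rw [thermalCorr_onSitePair_eq]
  refine Eq.trans_le ?_ (key.trans_eq ?_)
  · congr!
  · congr!

/-- **Koma–Tasaki's printed a priori bound on the torus (`a = 1`).** Pull-back of
`norm_thermalCorr_pair_le_exp_sharp` (`‖c†_u c_v + c†_v c_u‖ ≤ 1`, KomaTasakiPRL1992 eq. (11)),
for every real site function `φ` and `β ≥ 0`. -/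
theorem apriori_one (L : ℕ) [NeZero L] (t U μ β : ℝ) (hβ : 0 ≤ β) (x y : TorusSite 2 L)
    (φ : TorusSite 2 L → ℝ) :
    ‖(hubbardTorusWith 2 L t U μ).thermalCorr β (onSitePair x)ᴴ (onSitePair y)‖ ≤
      Real.exp (-2 * (φ x - φ y)) * Real.exp (β * (|t| * (1 *
        ∑ u : TorusSite 2 L, ∑ v : TorusSite 2 L,
          (if (torusGraph 2 L).Adj u v then (Real.cosh (φ u - φ v) - 1) else 0)))) := by
  have key := norm_thermalCorr_pair_le_exp_sharp (fermionTorusGraph 2 L) t U μ hβ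
    (fun u => φ (FermionTorus.toTorusSite u)) (FermionTorus.ofTorusSite x)
    (FermionTorus.ofTorusSite y)
  have hsumeq : (∑ u : FermionTorus 2 L, ∑ v : FermionTorus 2 L,
      if (fermionTorusGraph 2 L).Adj u v then
        (Real.cosh (φ (FermionTorus.toTorusSite u) - φ (FermionTorus.toTorusSite v)) - 1)
      else 0) =
      ∑ a : TorusSite 2 L, ∑ b : TorusSite 2 L,
        if (torusGraph 2 L).Adj a b then (Real.cosh (φ a - φ b) - 1) else 0 := by
    refine Fintype.sum_equiv FermionTorus.equivTorusSite _ _ fun u => ?_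
    refine Fintype.sum_equiv FermionTorus.equivTorusSite _ _ fun v => ?_
    simp [FermionTorus.equivTorusSite]
  simp only [FermionTorus.toTorusSite_ofTorusSite] at key
  rw [hsumeq] at key
  rw [thermalCorr_onSitePair_eq, one_mul]
  refine Eq.trans_le ?_ (key.trans_eq ?_)
  · congr!
  · congr!

/-! ### The explicit power laws -/

/-- **The dipole bound with the tree's hopping norm (`a = 2`)**: for all real `t, U, μ`,
`β ≥ 0`, every `q` with `f_q = 4q - 32 β|t| q² e^{q²/2} ≥ 0`, every torus `L ≥ 1` and all sites:
`|G_{β,L}(x,y)| ≤ 4^{f_q} (dist(x,y)+1)^{-f_q}`. -/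
theorem norm_pairCorr_le_rpow_dipole (L : ℕ) [NeZero L] (t U μ β q : ℝ) (hβ : 0 ≤ β)
    (hf : 0 ≤ 4 * q - 16 * 2 * (β * |t|) * (q ^ 2 * Real.exp (q ^ 2 / 2)))
    (x y : TorusSite 2 L) :
    ‖(hubbardTorusWith 2 L t U μ).thermalCorr β (onSitePair x)ᴴ (onSitePair y)‖ ≤
      (4 : ℝ) ^ (4 * q - 16 * 2 * (β * |t|) * (q ^ 2 * Real.exp (q ^ 2 / 2))) *
        ((torusDist x y : ℝ) + 1) ^
          (-(4 * q - 16 * 2 * (β * |t|) * (q ^ 2 * Real.exp (q ^ 2 / 2)))) :=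
  norm_pairCorr_le_rpow_dipole_of_apriori L t U μ β 2 q hβ (by norm_num) x y
    (apriori_two L t U μ β hβ x y) hf

/-- **The dipole bound with Koma–Tasaki's printed hopping norm (`a = 1`)**: for all real
`t, U, μ`, `β ≥ 0`, every `q` with `f_q = 4q - 16 β|t| q² e^{q²/2} ≥ 0`, every torus `L ≥ 1`
and all sites: `|G_{β,L}(x,y)| ≤ 4^{f_q} (dist(x,y)+1)^{-f_q}`. With `q = T/(8|t|)`:
`f = (T/(4|t|))(2 - e^{T²/(128 t²)})`, i.e. the `ℓ^∞` exponent `η_∞(T) ≈ T/(4|t|)`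
(paper, Euclidean: `T/(π|t|)`). -/
theorem norm_pairCorr_le_rpow_dipole_sharp (L : ℕ) [NeZero L] (t U μ β q : ℝ) (hβ : 0 ≤ β)
    (hf : 0 ≤ 4 * q - 16 * 1 * (β * |t|) * (q ^ 2 * Real.exp (q ^ 2 / 2)))
    (x y : TorusSite 2 L) :
    ‖(hubbardTorusWith 2 L t U μ).thermalCorr β (onSitePair x)ᴴ (onSitePair y)‖ ≤
      (4 : ℝ) ^ (4 * q - 16 * 1 * (β * |t|) * (q ^ 2 * Real.exp (q ^ 2 / 2))) *
        ((torusDist x y : ℝ) + 1) ^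
          (-(4 * q - 16 * 1 * (β * |t|) * (q ^ 2 * Real.exp (q ^ 2 / 2)))) :=
  norm_pairCorr_le_rpow_dipole_of_apriori L t U μ β 1 q hβ (by norm_num) x y
    (apriori_one L t U μ β hβ x y) hf

/-! ### The machine-checked `η`-lines -/

/-- **Cor 10.1′ (torus form, tree hopping norm; PROVED below).** For the Hubbard model on
`(ℤ/Lℤ)²` with any real `t, U, μ`: if `β|t| ≤ 99/200` (temperature `T ≥ 2.03|t|`) there are an
exponent `f > 1/4` and a constant `C` (here `C = 4^f`) with
`|⟨c†_{x↑} c†_{x↓} c_{y↓} c_{y↑}⟩_{β,L}| ≤ C (dist(x,y)+1)^{-f}` for EVERY `L ≥ 1` and all `x, y`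
— uniformly faster than the Nelson–Kosterlitz borderline `r^{-1/4}`: no KT pair quasi-condensate
(`η ≤ 1/4`) there, whatever `U`, `μ`. Improves `PairEtaLineTorus` (`T > 32|t|`) by the factor
`16` of the dipole. kind: support (PROVED). Why it might fail: it cannot (proved); what is NOT
claimed is sharpness — see `PairEtaLineDipoleSharp` (factor `2`) and `PairEtaLineSharp`
(Euclidean, `(π/4)|t|`, typed only). Sources: KomaTasakiPRL1992 Theorem, eqs. (11)–(13), note 9;
McBryanSpencer1977; NelsonKosterlitz1977; this cell bounds.tex Thm 10 / Remark 10′. -/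
@[conjecture] def PairEtaLineDipole : Prop :=
  ∀ (t U μ β : ℝ), 0 < β → β * |t| ≤ 99 / 200 →
    ∃ f C : ℝ, 1 / 4 < f ∧ ∀ (L : ℕ) [NeZero L] (x y : TorusSite 2 L),
      ‖(hubbardTorusWith 2 L t U μ).thermalCorr β (onSitePair x)ᴴ (onSitePair y)‖ ≤
        C * ((torusDist x y : ℝ) + 1) ^ (-f)

/-- **Cor 10.1″ (torus form, Koma–Tasaki's printed hopping norm; PROVED below).** As
`PairEtaLineDipole` with the threshold `β|t| ≤ 99/100` (temperature `T ≥ 1.02|t|`): for every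
real `t, U, μ` there are `f > 1/4` and `C` with `|G_{β,L}(x,y)| ≤ C (dist(x,y)+1)^{-f}` for all
`L, x, y`. This is the best `η`-line this cell has MACHINE-CHECKED; the `ℓ^∞`-method optimum is
`T > 1.008|t|`, the paper's Euclidean optimum (bounds.tex Thm 10 (iii), typed as
`PairEtaLineSharp`) is `T > (π/4)|t|`. kind: support (PROVED). Why it might fail: it cannot.
Sources: KomaTasakiPRL1992 eq. (11) ("‖c†c + h.c.‖ = 1"), eqs. (12)–(13), note 9;
McBryanSpencer1977; NelsonKosterlitz1977. -/
@[conjecture] def PairEtaLineDipoleSharp : Prop :=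
  ∀ (t U μ β : ℝ), 0 < β → β * |t| ≤ 99 / 100 →
    ∃ f C : ℝ, 1 / 4 < f ∧ ∀ (L : ℕ) [NeZero L] (x y : TorusSite 2 L),
      ‖(hubbardTorusWith 2 L t U μ).thermalCorr β (onSitePair x)ᴴ (onSitePair y)‖ ≤
        C * ((torusDist x y : ℝ) + 1) ^ (-f)

/-- `e^{1/128} ≤ 1 + 1/128 + 1/128² = 16513/16384` (Taylor remainder
`Real.abs_exp_sub_one_sub_id_le`). -/
theorem exp_inv128_le : Real.exp ((1 / 8 : ℝ) ^ 2 / 2) ≤ 16513 / 16384 := by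
  have h := Real.abs_exp_sub_one_sub_id_le (x := (1 / 8 : ℝ) ^ 2 / 2)
    (by rw [abs_le]; constructor <;> norm_num)
  have h2 := (abs_le.1 h).2
  norm_num at h2 ⊢
  linarith

/-- **`PairEtaLineDipole` holds** (witness `q = 1/8`, `C = 4^f`,
`f = 1/2 - β|t| e^{1/128}/2 ≥ 1/2 - (99/200)(16513/16384)/2 > 1/4`). -/
theorem pairEtaLineDipole_holds : PairEtaLineDipole := by
  intro t U μ β hβ hb
  have hE := exp_inv128_le
  have hEpos := Real.exp_pos ((1 / 8 : ℝ) ^ 2 / 2)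
  have hbt : 0 ≤ β * |t| := by positivity
  set f : ℝ := 4 * (1 / 8 : ℝ) -
    16 * 2 * (β * |t|) * ((1 / 8 : ℝ) ^ 2 * Real.exp ((1 / 8 : ℝ) ^ 2 / 2)) with hf
  have hprod : (β * |t|) * Real.exp ((1 / 8 : ℝ) ^ 2 / 2) ≤ (99 / 200) * (16513 / 16384) :=
    mul_le_mul hb hE hEpos.le (by norm_num)
  have hf4 : 1 / 4 < f := by
    rw [hf]
    nlinarith [hprod]
  refine ⟨f, (4 : ℝ) ^ f, hf4, fun L _ x y => ?_⟩
  exact norm_pairCorr_le_rpow_dipole L t U μ β (1 / 8) hβ.le (by linarith) x y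

/-- **`PairEtaLineDipoleSharp` holds** (witness `q = 1/8`, `C = 4^f`,
`f = 1/2 - β|t| e^{1/128}/4 ≥ 1/2 - (99/100)(16513/16384)/4 > 1/4`). -/
theorem pairEtaLineDipoleSharp_holds : PairEtaLineDipoleSharp := by
  intro t U μ β hβ hb
  have hE := exp_inv128_le
  have hEpos := Real.exp_pos ((1 / 8 : ℝ) ^ 2 / 2)
  have hbt : 0 ≤ β * |t| := by positivity
  set f : ℝ := 4 * (1 / 8 : ℝ) -
    16 * 1 * (β * |t|) * ((1 / 8 : ℝ) ^ 2 * Real.exp ((1 / 8 : ℝ) ^ 2 / 2)) with hf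
  have hprod : (β * |t|) * Real.exp ((1 / 8 : ℝ) ^ 2 / 2) ≤ (99 / 100) * (16513 / 16384) :=
    mul_le_mul hb hE hEpos.le (by norm_num)
  have hf4 : 1 / 4 < f := by
    rw [hf]
    nlinarith [hprod]
  refine ⟨f, (4 : ℝ) ^ f, hf4, fun L _ x y => ?_⟩
  exact norm_pairCorr_le_rpow_dipole_sharp L t U μ β (1 / 8) hβ.le (by linarith) x y

end Summit.HubbardSuperconductivity.HubbardLadder.Bounds
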